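import Literature.AlgebraicGeometry.Motives.LinearCohomologyAbComparison
import Literature.AlgebraicGeometry.Motives.LinearCohomologyEllAdicTower
import Literature.AlgebraicGeometry.Motives.EllAdicComparison
import HarnessLib

/-!
# The `R`-linear `ℓ`-adic tower `(Hⁿ(X_ét, ℤ/ℓᵐ))ₘ` and the tree's tower of Mathlib groups agree:
# `etaleZModPowCohomology X ℓ m n ≃+ etaleCohomologyZModPow X ℓ n m`, compatibly with the
# transition maps, whence `lim_m Hⁿ(X_ét, ℤ/ℓᵐ) ≃ₗ[ℤ_ℓ] towerLim (etaleCohomologyZModPowMap X ℓ n)`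

`LinearCohomologyEllAdicTower.lean` builds `ℓ`-adic cohomology `R`-linearly — levels
`Hⁿ(X_ét, ℤ/ℓᵐ) = Extⁿ_{S(X_ét, ℤ/ℓᵐ)}((ℤ/ℓᵐ)_X, (ℤ/ℓᵐ)_X)` with cup products, transition maps
`ρ_m` (`zmodPowReduction`, ring homomorphisms), `lim` with its `ℤ_ℓ`-module structure — while
the tree's étale-cohomology facts (Milne VI Cor. 2.8 `finite_etaleCohomology_of_isProper`,
Bhatt–Scholze Prop. 5.6.2 `ellAdicCohomology_limOneSequence`, `EllAdicComparison.lean`, the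
Galois actions of `EllAdicEtalePullback.lean`, …) live on Mathlib's `Sheaf.H` of the constant
abelian sheaves `ℤ/ℓᵐ` (`etaleCohomologyZModPow`, transition maps `etaleCohomologyZModPowMap`).
This file identifies the two towers (Milne V §1, p. 175: "the cohomology of a sheaf of
`ℤ/(n)`-modules agrees with its cohomology as a sheaf of `ℤ`-modules"), everything PROVED:

* `etaleZModPowCohomologyAbEquiv X ℓ m n : etaleZModPowCohomology X ℓ m n ≃+ etaleCohomologyZModPow X ℓ n m`
  — the level isomorphisms (`etaleModCohomologyAbEquiv` of `LinearCohomologyAbComparison.lean`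
  for `R = ℤ/ℓᵐ`);
* `etaleZModPowCohomologyAbEquiv_zmodPowReduction` — **they commute with the transition maps**
  `ρ_m` and `Hⁿ(ℤ/ℓᵐ⁺¹ → ℤ/ℓᵐ)`. This is the generic `toAbCohomology_reductionMap`: for
  `φ : S ↠ R = S/(a)` (exact pair `(a, b)`), the reduction `ρ : Hⁿ_S(X, S) → Hⁿ_R(X, R)` of
  `LinearCohomologyChangeOfRings.lean` corresponds under the comparisons to `Hⁿ` of Mathlib's map
  of constant sheaves `S_X → R_X`; its proof is the **transitivity of the change of rings**
  `ℤ → S → R` (`changeOfRingsMap_trans`, `toAbCohomology_trans`: `c_{ℤS} ∘ c_{SR} = c_{ℤR}`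
  up to the identity-on-sections isomorphism `res_{ℤS} res_{SR} ≅ res_{ℤR}`,
  `restrictScalarsSheafCompIso`, by the functoriality of `Ext.mapExactFunctor` along natural
  isomorphisms and the composition of the unit maps `r`, `changeOfRingsUnit_trans`, checked on
  the unit section) and the **reduction square of constant abelian sheaves**
  (`toAbSheaf_map_changeOfRingsUnit`: `(S_X)_ab ≅ S_X`, `(R_X)_ab ≅ R_X` transform `r_ab` into
  `(constantSheaf J Ab).map φ`, both sending the constant section of `s` to that of `φ s`);
* `etaleEllAdicTowerCohomologyAbEquiv X ℓ n : etaleEllAdicTowerCohomology X ℓ n ≃+ towerLim (etaleCohomologyZModPowMap X ℓ n)`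
  (`towerLim.congrAddEquiv`), `ℤ_ℓ`-linear for the canonical module structures
  (`etaleEllAdicTowerCohomologyAbEquiv_smul`, `etaleEllAdicTowerCohomologyLinearEquiv`);
* `finite_etaleZModPowCohomology_of_fact` — the `R`-linear levels `Hⁱ(Y_ét, ℤ/ℓᵐ)` of a proper
  `Y` over a separably closed field are finite, from the named fact
  `finite_etaleCohomology_of_isProper` (Milne VI Cor. 2.8) taken as a hypothesis.

## References

* J. S. Milne, *Étale cohomology*, Princeton (reissue 2025; held copy, PDF pages): III Ex. 2.25
  (p. 119), V §1 (pp. 175–176), VI Cor. 2.8. [Milne2025]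

## Design notes

* The coefficient objects agree on the nose: `AddCommGrpCat.of (ZModPow ℓ m) = zmodPowAb ℓ m` and
  `AddCommGrpCat.ofHom (zmodPowRed ℓ m) = zmodPowAbRed ℓ m` hold by `rfl`, so the generic
  statements specialise to the tree's `etaleCohomologyZModPow(Map)` without transport.
* The torsion `Fact` for `towerLim (etaleCohomologyZModPowMap X ℓ n)` (instance
  `fact_pow_smul_etaleCohomologyZModPow`, `EllAdicEtalePullback.lean`) is a hypothesis of the
  `ℤ_ℓ`-linear statements rather than an import, to keep this file below the Galois-action files.
-/

open CategoryTheory CategoryTheory.Limits CategoryTheory.Abelian Opposite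

universe w v u

noncomputable section

namespace Literature.AlgebraicGeometry.Motives

/-! ### The unit map `r : S_X → res R_X` on the unit section -/

section UnitSection

variable {C : Type u} [Category.{w} C] {J : GrothendieckTopology C} {T : C} (hT : IsTerminal T)
variable {S R : Type w} [CommRing S] [CommRing R] (φ : S →+* R)
variable [HasSheafify J (ModuleCat.{w} S)] [HasSheafify J (ModuleCat.{w} R)]

omit [HasSheafify J (ModuleCat.{w} S)] in
/-- The unit section `u ∈ R_X(T)` is the constant section of `1`. [folklore] -/
theorem unitSection_eq_constantSection :
    unitSection (J := J) φ hT = constantSection J (ModuleCat.of R R) T (1 : R) := by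
  change ((constantSheafAdj J (ModuleCat.{w} R) hT).unit.app (ModuleCat.of R R)).hom (1 : R) = _
  rw [constantSheafAdj_unit_app]
  rfl

/-- **`r : S_X → res R_X` maps the unit section of `S_X` to the unit section of `R_X`**
(`r` is adjoint to `θ : s ↦ s · u`, so `r_T(η_S(1)) = θ(1) = u`). [folklore] -/
theorem changeOfRingsUnit_app_constantSection_one :
    (changeOfRingsUnit (J := J) φ hT).hom.app (op T) (constantSection J (ModuleCat.of S S) T (1 : S)) =
      unitSection (J := J) φ hT := by
  have h : (constantSheafAdj J (ModuleCat.{w} S) hT).homEquiv _ _ (changeOfRingsUnit (J := J) φ hT) =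
      changeOfRingsUnitHom φ hT := by
    rw [changeOfRingsUnit, Equiv.apply_symm_apply]
  rw [Adjunction.homEquiv_unit, constantSheafAdj_unit_app] at h
  have h1 := congrArg (fun f => (ConcreteCategory.hom f) (1 : S)) h
  simp only [ModuleCat.hom_comp, LinearMap.comp_apply] at h1
  refine h1.trans ?_
  change LinearMap.toSpanSingleton S _ (unitSection φ hT) (1 : S) = _
  rw [LinearMap.toSpanSingleton_apply, one_smul]

/-- **`r : S_X → res R_X` on constant sections**: `r_T(η_S(s)) = η_R(φ s)` (`S`-linearity of `r_T`
and `η_S`, `r_T(η_S(1)) = η_R(1)`, and the `S`-action on `res R_X(T)` through `φ`). [folklore] -/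
theorem changeOfRingsUnit_app_constantSection (s : S) :
    (changeOfRingsUnit (J := J) φ hT).hom.app (op T) (constantSection J (ModuleCat.of S S) T s) =
      constantSection J (ModuleCat.of R R) T (φ s) := by
  have hs : constantSection J (ModuleCat.of S S) T s = s • constantSection J (ModuleCat.of S S) T 1 := by
    rw [← map_smul, smul_eq_mul, mul_one]
  rw [hs, map_smul, changeOfRingsUnit_app_constantSection_one, unitSection_eq_constantSection]
  change φ s • constantSection J (ModuleCat.of R R) T (1 : R) = _
  rw [← map_smul, smul_eq_mul, mul_one]

end UnitSection

/-! ### Transitivity of the change of rings along `ULift ℤ → S → R` -/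

section Trans

variable {C : Type u} [Category.{w} C] {J : GrothendieckTopology C} {T : C} (hT : IsTerminal T)
variable {S R : Type w} [CommRing S] [CommRing R] (φ : S →+* R)

/-- `ULift ℤ → S → R` is `ULift ℤ → R` (uniqueness of ring homomorphisms from `ℤ`). [folklore] -/
theorem ulintCastRingHom_comp : ulintCastRingHom R = φ.comp (ulintCastRingHom S) := by
  ext u
  simp [ulintCastRingHom_apply]

variable (J) in
/-- **`res_{ℤS} ∘ res_{SR} ≅ res_{ℤR}`** on sheaves of modules: restricting scalars from `R` to `S`
and then to `ULift ℤ` is restricting to `ULift ℤ` (identity on sections; Mathlib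
`ModuleCat.restrictScalarsComp'`). [folklore] -/
def restrictScalarsSheafCompIso :
    restrictScalarsSheaf J φ ⋙ restrictScalarsSheaf J (ulintCastRingHom S) ≅
      restrictScalarsSheaf J (ulintCastRingHom R) :=
  NatIso.ofComponents
    (fun G => (fullyFaithfulSheafToPresheaf J (ModuleCat.{w} (ULift.{w} ℤ))).preimageIso
      (Functor.isoWhiskerLeft G.obj
        (ModuleCat.restrictScalarsComp'.{w} (ulintCastRingHom S) φ (ulintCastRingHom R)
          (ulintCastRingHom_comp φ)).symm))
    (by
      intro G G' ψ
      apply Sheaf.hom_ext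
      ext U x
      rfl)

/-- The components of `restrictScalarsSheafCompIso` are the identity on sections. [folklore] -/
@[simp]
theorem restrictScalarsSheafCompIso_hom_app_apply (G : Sheaf J (ModuleCat.{w} R)) (U : Cᵒᵖ)
    (x : G.obj.obj U) :
    ((restrictScalarsSheafCompIso J φ).hom.app G).hom.app U x = x :=
  rfl

/-- **`(res_{SR} G)_ab ≅ G_ab`**: the underlying abelian sheaf does not see the restriction of
scalars (the identity on sections; `restrictScalarsSheafCompIso` after `intForget`). [folklore] -/
def toAbSheafRestrictScalarsIso (G : Sheaf J (ModuleCat.{w} R)) :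
    (toAbSheaf J S).obj ((restrictScalarsSheaf J φ).obj G) ≅ (toAbSheaf J R).obj G :=
  (sheafCompose J intForget.{w}).mapIso ((restrictScalarsSheafCompIso J φ).app G)

/-- `toAbSheafRestrictScalarsIso` is the identity on sections. [folklore] -/
@[simp]
theorem toAbSheafRestrictScalarsIso_hom_app_apply (G : Sheaf J (ModuleCat.{w} R)) (U : Cᵒᵖ)
    (x : G.obj.obj U) :
    ((toAbSheafRestrictScalarsIso (J := J) φ G).hom.hom.app U : _ → _) x = x :=
  rfl

variable [HasSheafify J (ModuleCat.{w} S)] [HasSheafify J (ModuleCat.{w} R)]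
  [HasSheafify J (ModuleCat.{w} (ULift.{w} ℤ))]

/-- **The unit maps compose**: `r_{ℤS} ≫ res(r_{SR}) ≫ e = r_{ℤR}` as maps `(ULift ℤ)_X → res R_X`
(all three send the unit section of `(ULift ℤ)_X` to the unit section of `R_X`; maps out of a
constant sheaf are determined by the image of the unit section). [folklore] -/
theorem changeOfRingsUnit_trans :
    (changeOfRingsUnit (J := J) (ulintCastRingHom S) hT ≫
        (restrictScalarsSheaf J (ulintCastRingHom S)).map (changeOfRingsUnit (J := J) φ hT)) ≫
          (restrictScalarsSheafCompIso J φ).hom.app (constantSheafSelf J R) =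
      changeOfRingsUnit (J := J) (ulintCastRingHom R) hT := by
  apply constantSheaf_hom_ext hT
  ext : 1
  apply LinearMap.ext_ring
  change ((restrictScalarsSheafCompIso J φ).hom.app (constantSheafSelf J R)).hom.app (op T)
      ((changeOfRingsUnit (J := J) φ hT).hom.app (op T)
        ((changeOfRingsUnit (J := J) (ulintCastRingHom S) hT).hom.app (op T)
          (constantSection J (ModuleCat.of (ULift.{w} ℤ) (ULift.{w} ℤ)) T 1))) =
    (changeOfRingsUnit (J := J) (ulintCastRingHom R) hT).hom.app (op T)
      (constantSection J (ModuleCat.of (ULift.{w} ℤ) (ULift.{w} ℤ)) T 1)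
  rw [changeOfRingsUnit_app_constantSection_one, changeOfRingsUnit_app_constantSection_one,
    unitSection_eq_constantSection, restrictScalarsSheafCompIso_hom_app_apply]
  erw [changeOfRingsUnit_app_constantSection_one]
  rfl

variable [IsGrothendieckAbelian.{w} (Sheaf J (ModuleCat.{w} S))]
  [IsGrothendieckAbelian.{w} (Sheaf J (ModuleCat.{w} R))]
  [IsGrothendieckAbelian.{w} (Sheaf J (ModuleCat.{w} (ULift.{w} ℤ)))]

set_option backward.isDefEq.respectTransparency false in
/-- **Transitivity of the change of rings** `ℤ → S → R`: `c_{ℤS}(c_{SR}(y))`, transported along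
`res_{ℤS} res_{SR} G ≅ res_{ℤR} G`, is `c_{ℤR}(y)`. [folklore] -/
theorem changeOfRingsMap_trans (G : Sheaf J (ModuleCat.{w} R)) (n : ℕ) (y : linearCohomology R G n) :
    (changeOfRingsMap (ulintCastRingHom S) hT ((restrictScalarsSheaf J φ).obj G) n
        (changeOfRingsMap φ hT G n y)).comp
        (Ext.mk₀ ((restrictScalarsSheafCompIso J φ).hom.app G)) (add_zero n) =
      changeOfRingsMap (ulintCastRingHom R) hT G n y := by
  rw [changeOfRingsMap_apply, changeOfRingsMap_apply, changeOfRingsMap_apply,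
    Ext.mapExactFunctor_comp, Ext.mapExactFunctor_mk₀, ← Ext.mapExactFunctor_functorComp,
    Ext.comp_assoc_of_third_deg_zero, Ext.comp_assoc_of_third_deg_zero,
    Ext.mapExactFunctor_comp_mk₀_iso_hom (restrictScalarsSheafCompIso J φ) y,
    ← Ext.comp_assoc_of_second_deg_zero, ← Ext.comp_assoc_of_second_deg_zero, Ext.mk₀_comp_mk₀,
    Ext.mk₀_comp_mk₀, changeOfRingsUnit_trans]

variable [HasSheafify J AddCommGrpCat.{w}] [IsGrothendieckAbelian.{w} (Sheaf J AddCommGrpCat.{w})]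

set_option backward.isDefEq.respectTransparency false in
/-- **Transitivity of the comparison with `Sheaf.H`**: `toAb_R(y) = Hⁿ(e) (toAb_S(c_{SR} y))`, where
`e : (res_{SR} G)_ab ≅ G_ab` is the identity on sections. [folklore] -/
theorem toAbCohomology_trans (G : Sheaf J (ModuleCat.{w} R)) (n : ℕ) (y : linearCohomology R G n) :
    toAbCohomology J hT G n y =
      Sheaf.H.map (toAbSheafRestrictScalarsIso (J := J) φ G).hom n
        (toAbCohomology J hT ((restrictScalarsSheaf J φ).obj G) n (changeOfRingsMap φ hT G n y)) := by
  rw [toAbCohomology_apply, toAbCohomology_apply, ← changeOfRingsMap_trans hT φ G n y,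
    Ext.mapExactFunctor_comp, Ext.mapExactFunctor_mk₀, Sheaf.H.map_apply,
    Ext.comp_assoc_of_third_deg_zero]
  rfl

end Trans

/-! ### Constant sections: naturality in the coefficients and the inverse isomorphisms -/

section ConstantSectionNaturality

variable {C : Type u} [Category.{v} C] (J : GrothendieckTopology C) {D : Type*} [Category D]
  [HasWeakSheafify J D]

/-- **Constant sections are natural in the coefficients**: for `f : M → M'`,
`η_{M'} ∘ f = M_X(f) ∘ η_M` over any object. [folklore] -/
theorem constantSection_naturality {M M' : D} (f : M ⟶ M') (U : C) :
    constantSection J M U ≫ ((constantSheaf J D).map f).hom.app (op U) =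
      f ≫ constantSection J M' U := by
  have h := congrArg (fun α => NatTrans.app α (op U))
    (toSheafify_naturality J ((Functor.const Cᵒᵖ).map f))
  simp only [NatTrans.comp_app, Functor.const_map_app] at h
  exact h.symm

end ConstantSectionNaturality

section ReductionSquare

variable {C : Type u} [Category.{w} C] (J : GrothendieckTopology C) {T : C} (hT : IsTerminal T)
variable {S R : Type w} [CommRing S] [CommRing R] (φ : S →+* R)
variable [HasSheafify J (ModuleCat.{w} S)] [HasSheafify J (ModuleCat.{w} R)]
  [HasSheafify J (ModuleCat.{w} (ULift.{w} ℤ))] [HasSheafify J AddCommGrpCat.{w}]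

/-- `toAbSheafConstantSheafIso⁻¹` maps constant sections to constant sections. [folklore] -/
theorem constantSection_toAbSheafConstantSheafIso_inv (X' : C) (r : R) :
    (toAbSheafConstantSheafIso J R).inv.hom.app (op X') (constantSection J (AddCommGrpCat.of R) X' r) =
      constantSection J (ModuleCat.of R R) X' r := by
  rw [← constantSection_toAbSheafConstantSheafIso_hom J R X' r]
  change ((toAbSheafConstantSheafIso J R).hom ≫ (toAbSheafConstantSheafIso J R).inv).hom.app (op X') _ = _
  rw [Iso.hom_inv_id]
  rfl

/-- **The reduction square of constant abelian sheaves**: under `(S_X)_ab ≅ S_X` and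
`(R_X)_ab ≅ R_X`, the underlying abelian map of `r : S_X → res R_X` (followed by the identity
`(res R_X)_ab = (R_X)_ab`) is Mathlib's `(constantSheaf J Ab).map φ` (both send the constant
section of `s` to the constant section of `φ s`). [folklore] -/
theorem toAbSheaf_map_changeOfRingsUnit :
    (toAbSheafConstantSheafIso J S).inv ≫ (toAbSheaf J S).map (changeOfRingsUnit (J := J) φ hT) ≫
      (toAbSheafRestrictScalarsIso (J := J) φ (constantSheafSelf J R)).hom ≫
        (toAbSheafConstantSheafIso J R).hom =
    (constantSheaf J AddCommGrpCat.{w}).map (AddCommGrpCat.ofHom φ.toAddMonoidHom) := by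
  apply constantSheaf_hom_ext hT
  ext s
  change (toAbSheafConstantSheafIso J R).hom.hom.app (op T)
      ((toAbSheafRestrictScalarsIso (J := J) φ (constantSheafSelf J R)).hom.hom.app (op T)
        ((changeOfRingsUnit (J := J) φ hT).hom.app (op T)
          ((toAbSheafConstantSheafIso J S).inv.hom.app (op T)
            (constantSection J (AddCommGrpCat.of S) T s)))) =
    ((constantSheaf J AddCommGrpCat.{w}).map (AddCommGrpCat.ofHom φ.toAddMonoidHom)).hom.app (op T)
      (constantSection J (AddCommGrpCat.of S) T s)
  rw [constantSection_toAbSheafConstantSheafIso_inv, changeOfRingsUnit_app_constantSection,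
    toAbSheafRestrictScalarsIso_hom_app_apply, constantSection_toAbSheafConstantSheafIso_hom]
  exact (congrArg (fun f => (ConcreteCategory.hom f) s)
    (constantSection_naturality J (AddCommGrpCat.ofHom φ.toAddMonoidHom) T)).symm

variable [IsGrothendieckAbelian.{w} (Sheaf J (ModuleCat.{w} S))]
  [IsGrothendieckAbelian.{w} (Sheaf J (ModuleCat.{w} R))]
  [IsGrothendieckAbelian.{w} (Sheaf J (ModuleCat.{w} (ULift.{w} ℤ)))]
  [IsGrothendieckAbelian.{w} (Sheaf J AddCommGrpCat.{w})]

set_option backward.isDefEq.respectTransparency false in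
/-- **The comparison commutes with reduction of coefficients**: for `φ : S ↠ R = S/(a)` with an
exact pair `(a, b)` (the transition `ℤ/ℓᵐ⁺¹ ↠ ℤ/ℓᵐ` of the `ℓ`-adic tower), the reduction
`ρ : Hⁿ_S(X, S) → Hⁿ_R(X, R)` of `LinearCohomologyChangeOfRings.lean` corresponds, under the
comparisons `Hⁿ_S(X, S) → Hⁿ(X, S_X)`, `Hⁿ_R(X, R) → Hⁿ(X, R_X)` with Mathlib's `Sheaf.H`, to
`Hⁿ` of the map of constant sheaves `S_X → R_X` induced by `φ`. [folklore] -/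
theorem toAbCohomology_reductionMap (hφ : Function.Surjective φ) {a b : S}
    (hker : RingHom.ker φ = Ideal.span {a}) (hab : a * b = 0)
    (ha : ∀ s : S, s * a = 0 → ∃ t, s = t * b) (hb : ∀ s : S, s * b = 0 → ∃ t, s = t * a)
    (n : ℕ) (x : linearCohomology S (constantSheafSelf J S) n) :
    Sheaf.H.map (toAbSheafConstantSheafIso J R).hom n
        (toAbCohomology J hT (constantSheafSelf J R) n (reductionMap φ hT hφ hker hab ha hb n x)) =
      Sheaf.H.map ((constantSheaf J AddCommGrpCat.{w}).map (AddCommGrpCat.ofHom φ.toAddMonoidHom)) n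
        (Sheaf.H.map (toAbSheafConstantSheafIso J S).hom n
          (toAbCohomology J hT (constantSheafSelf J S) n x)) := by
  rw [toAbCohomology_trans hT φ, changeOfRingsMap_reductionMap, toAbCohomology_map,
    ← Sheaf.H.map_comp_apply, ← Sheaf.H.map_comp_apply, ← Sheaf.H.map_comp_apply,
    ← toAbSheaf_map_changeOfRingsUnit J hT φ, Iso.hom_inv_id_assoc]

end ReductionSquare

/-! ### Towers: `lim` of levelwise additive equivalences -/

section TowerEquiv

variable {A B : ℕ → Type v} [∀ m, AddCommGroup (A m)] [∀ m, AddCommGroup (B m)]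
  {f : ∀ m, A (m + 1) →+ A m} {g : ∀ m, B (m + 1) →+ B m}

/-- **An isomorphism of towers induces an isomorphism of inverse limits**: levelwise additive
equivalences commuting with the transition maps give `lim_m A_m ≃+ lim_m B_m`. [folklore] -/
def towerLim.congrAddEquiv (e : ∀ m, A m ≃+ B m)
    (he : ∀ m (a : A (m + 1)), e m (f m a) = g m (e (m + 1) a)) : towerLim f ≃+ towerLim g where
  toFun a := ⟨fun m => e m (a.1 m), by
    rw [mem_towerLim_iff]
    intro m
    rw [← he, (mem_towerLim_iff f).1 a.2 m]⟩
  invFun b := ⟨fun m => (e m).symm (b.1 m), by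
    rw [mem_towerLim_iff]
    intro m
    apply (e m).injective
    rw [he, AddEquiv.apply_symm_apply, AddEquiv.apply_symm_apply, (mem_towerLim_iff g).1 b.2 m]⟩
  left_inv a := by ext m; exact (e m).symm_apply_apply _
  right_inv b := by ext m; exact (e m).apply_symm_apply _
  map_add' a a' := by ext m; exact map_add (e m) _ _

/-- Components of `towerLim.congrAddEquiv`. [folklore] -/
@[simp]
theorem towerLim.coe_congrAddEquiv_apply (e : ∀ m, A m ≃+ B m)
    (he : ∀ m (a : A (m + 1)), e m (f m a) = g m (e (m + 1) a)) (a : towerLim f) (m : ℕ) :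
    (towerLim.congrAddEquiv e he a : ∀ m, B m) m = e m (a.1 m) :=
  rfl

end TowerEquiv

/-! ### The `ℓ`-adic tower on the étale site: `Hⁿ(X_ét, ℤ/ℓᵐ)` `R`-linearly and in Mathlib agree -/

section Etale

open _root_.AlgebraicGeometry

variable (X : Scheme.{u}) (ℓ : ℕ) [hℓ : Fact ℓ.Prime]

omit hℓ in
/-- `ℤ → ℤ/ℓᵐ` (lifted) is onto. [folklore] -/
theorem intCast_zmodPow_surjective (m : ℕ) :
    Function.Surjective (Int.castRingHom (ZModPow.{u} ℓ m)) := by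
  rintro ⟨y⟩
  obtain ⟨z, rfl⟩ := ZMod.intCast_surjective y
  exact ⟨z, ULift.ext _ _ (by simp)⟩

/-- **`Hⁿ(X_ét, ℤ/ℓᵐ) ≃+ Hⁿ(X_ét, ℤ/ℓᵐ)`: the `ℤ/ℓᵐ`-linear level of the `ℓ`-adic tower**
(`etaleZModPowCohomology`, `LinearCohomologyEllAdicTower.lean`, with its cup product) **is the
tree's / Mathlib's `etaleCohomologyZModPow`** (`Sheaf.H` of the constant abelian sheaf `ℤ/ℓᵐ`,
`EllAdicComparison.lean`, the carrier of `finite_etaleCohomology_of_isProper` and of the `lim¹`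
sequence). Milne V §1 (p. 175). [cite: Milne2025, III Exercise 2.25] -/
def etaleZModPowCohomologyAbEquiv (m n : ℕ) :
    etaleZModPowCohomology X ℓ m n ≃+ etaleCohomologyZModPow X ℓ n m :=
  etaleModCohomologyAbEquiv X (ZModPow.{u} ℓ m) (intCast_zmodPow_surjective ℓ m) (ℓ ^ m)
    (pow_ne_zero m hℓ.out.ne_zero) n

set_option backward.isDefEq.respectTransparency false in
/-- **The level isomorphisms commute with the transition maps** of the two towers: the
`R`-linear reduction `ρ_m` (`zmodPowReduction`) and Mathlib's `Hⁿ(ℤ/ℓᵐ⁺¹ → ℤ/ℓᵐ)`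
(`etaleCohomologyZModPowMap`). [folklore] -/
theorem etaleZModPowCohomologyAbEquiv_zmodPowReduction (m n : ℕ)
    (x : etaleZModPowCohomology X ℓ (m + 1) n) :
    etaleZModPowCohomologyAbEquiv X ℓ m n (zmodPowReduction (isTerminalEtaleMkId X) ℓ m n x) =
      etaleCohomologyZModPowMap X ℓ n m (etaleZModPowCohomologyAbEquiv X ℓ (m + 1) n x) :=
  toAbCohomology_reductionMap.{u, u + 1} X.smallEtaleTopology (isTerminalEtaleMkId X)
    (zmodPowRed.{u} ℓ m) (zmodPowRed_surjective ℓ m) (ker_zmodPowRed ℓ m) (ZModPow.pow_mul_self ℓ m)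
    (ZModPow.exists_of_mul_pow_eq_zero ℓ m) (ZModPow.exists_of_mul_eq_zero ℓ m) n x

/-- **`lim_m Hⁿ(X_ét, ℤ/ℓᵐ)` computed `R`-linearly (`etaleEllAdicTowerCohomology`, with cup
product and `ℤ_ℓ`-structure) is the tree's `towerLim (etaleCohomologyZModPowMap X ℓ n)`**
(the `lim` of Mathlib's groups, the middle term of Bhatt–Scholze's `lim¹` sequence
`ellAdicCohomology_limOneSequence`). [cite: Milne2025, V §1 (p. 176)] -/
def etaleEllAdicTowerCohomologyAbEquiv (n : ℕ) :
    etaleEllAdicTowerCohomology X ℓ n ≃+ towerLim (etaleCohomologyZModPowMap X ℓ n) :=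
  towerLim.congrAddEquiv (fun m => etaleZModPowCohomologyAbEquiv X ℓ m n)
    (fun m x => etaleZModPowCohomologyAbEquiv_zmodPowReduction X ℓ m n x)

/-- Components: `(e a)_m = e_m(a_m)`. [folklore] -/
theorem coe_etaleEllAdicTowerCohomologyAbEquiv_apply (n : ℕ) (a : etaleEllAdicTowerCohomology X ℓ n)
    (m : ℕ) :
    (etaleEllAdicTowerCohomologyAbEquiv X ℓ n a : ∀ m, etaleCohomologyZModPow X ℓ n m) m =
      etaleZModPowCohomologyAbEquiv X ℓ m n (a.1 m) :=
  rfl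

/-- **The tower isomorphism is `ℤ_ℓ`-linear** for the canonical `ℤ_ℓ`-module structures
`(x • a)_m = (x mod ℓᵐ) • a_m` on both sides (`towerLim.instModulePadicInt`; on the right the
torsion `Fact` is the instance `fact_pow_smul_etaleCohomologyZModPow` of `EllAdicEtalePullback.lean`,
taken here as a hypothesis to keep imports light). [folklore] -/
theorem etaleEllAdicTowerCohomologyAbEquiv_smul (n : ℕ)
    [Fact (∀ m (a : etaleCohomologyZModPow X ℓ n m), ℓ ^ m • a = 0)] (x : ℤ_[ℓ])
    (a : etaleEllAdicTowerCohomology X ℓ n) :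
    etaleEllAdicTowerCohomologyAbEquiv X ℓ n (x • a) = x • etaleEllAdicTowerCohomologyAbEquiv X ℓ n a :=
  Subtype.ext <| funext fun m => by
    rw [coe_etaleEllAdicTowerCohomologyAbEquiv_apply, towerLim.coe_smul_apply,
      towerLim.coe_smul_apply, map_nsmul, coe_etaleEllAdicTowerCohomologyAbEquiv_apply]

/-- **`lim_m Hⁿ(X_ét, ℤ/ℓᵐ) ≃ₗ[ℤ_ℓ] towerLim (etaleCohomologyZModPowMap X ℓ n)`** (the tower
isomorphism as a `ℤ_ℓ`-linear equivalence, under the torsion `Fact` for the right-hand tower).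
[cite: Milne2025, V §1 (p. 176)] -/
def etaleEllAdicTowerCohomologyLinearEquiv (n : ℕ)
    [Fact (∀ m (a : etaleCohomologyZModPow X ℓ n m), ℓ ^ m • a = 0)] :
    etaleEllAdicTowerCohomology X ℓ n ≃ₗ[ℤ_[ℓ]] towerLim (etaleCohomologyZModPowMap X ℓ n) :=
  { etaleEllAdicTowerCohomologyAbEquiv X ℓ n with
    map_smul' := etaleEllAdicTowerCohomologyAbEquiv_smul X ℓ n }

/-- **Finiteness of the `R`-linear levels `Hⁱ(Y_ét, ℤ/ℓᵐ)` for `Y` proper over a separably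
closed field, from Milne VI Cor. 2.8** (the named fact `finite_etaleCohomology_of_isProper` of
`EllAdicComparison.lean`, taken as a hypothesis). [cite: Milne2025, VI Cor. 2.8] -/
theorem finite_etaleZModPowCohomology_of_fact (h₂ : finite_etaleCohomology_of_isProper.{u})
    (K : Type u) [Field K] [IsSepClosed K] (Y : Scheme.{u}) (f : Y ⟶ Spec (.of K)) [IsProper f]
    (m i : ℕ) : Finite (etaleZModPowCohomology Y ℓ m i) := by
  haveI : Finite (zmodPowAb.{u} ℓ m) := finite_zmodPowAb.{u} ℓ m hℓ.out.ne_zero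
  haveI : Finite (etaleCohomologyZModPow Y ℓ i m) := h₂ K Y f (zmodPowAb.{u} ℓ m) i
  exact Finite.of_equiv _ (etaleZModPowCohomologyAbEquiv Y ℓ m i).symm.toEquiv

end Etale

end Literature.AlgebraicGeometry.Motives

end
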